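import Literature.NumberTheory.Transcendental.ManyCurveThetaSplit
import Literature.NumberTheory.Transcendental.ManyCurveThetaTransvection
import Literature.NumberTheory.Transcendental.ThetaSubgroupDefinable
import HarnessLib

/-!
# Every connected algebraic subgroup of the `k`-lattice standard models has a `Θ`-definable preimage

Topic `Literature/NumberTheory/Transcendental`; unit
`provefact-Literature.NumberTheory.Transcendental.H-0a3eb64689` (fact
`Literature.NumberTheory.Transcendental.HuberWustholzManyCurvePeriods`, `ManyCurvePeriods.lean`).
It introduces NO named fact. Lattice-family counterpart of the one-lattice
`ThetaSubgroupTransport.lean` + `ThetaSubgroupDefinable.lean` for the theta model of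
`ManyCurveTheta.lean` (lattice family `L : 𝓙 → PeriodPair`, class map `cls : γ → 𝓙`): for EVERY
datum `K = (A, C, Ξ)` (`GaGmEFam.Std.SubgroupDataC`, `C` block-diagonal along the classes) the
preimage `exp⁻¹(G') = Lie G' + ker` (`GaGmEFam.Std.preimageSubgroup`) is the common zero set of a
set of theta forms (`GaGmEFam.Std.thetaDefinable_preimageSubgroup`), hence contains the closure
`Z(𝔍(Lie G'))` of its Lie algebra in any theta model
(`zeroSet_vanishing_tangent_subset_preimageSubgroup`).

Reduction to the split case of `ManyCurveThetaSplit.lean` by integer changes of the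
`E`-coordinates INSIDE THE CLASSES: the sign changes (`GaGmE.Std.flipMap`) and the transvections
`z'_{b₁} ↦ z'_{b₁} + z'_{b₂}` between blocks of the same class (`GaGmE.Std.tvMap`,
`ManyCurveThetaTransvection.lean`) are `Θ`-morphic isomorphisms `M_κ ≅ M_{κ'}` carrying `K` to a
(block-diagonal) datum `K'` (`flipData`, `tvData`), `Lie` to `Lie`, `ker` to `ker`, hence
`exp⁻¹(G'_K)` onto `exp⁻¹(G'_{K'})`; **Euclid** (`exists_split_step`) reduces a non-zero integer
vector of `C` supported in ONE class and off the already split coordinates `S` to a multiple of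
some `e_{b₀}`; block-diagonality supplies such vectors (`restr`), and the induction on
`dim C - |S|` concludes (`thetaDefinable_preimageSubgroup`). The generic row operations
(`GaGmE.Std.flipRow`, `tvRow`, `castQ`, `absSum`, `finrank_coordSpan`, …) of the one-lattice files
are reused.

## References

* Yu. V. Nesterenko, P. Philippon (eds.), *Introduction to Algebraic Independence Theory*,
  LNM 1752, Springer 2001, Ch. 11 (D. Roy), Thm. 4.1. [NesterenkoPhilippon2001]
* D. Bertrand, P. Philippon, *Sous-groupes algébriques de groupes algébriques commutatifs*,
  Illinois J. Math. 32 (1988), 263–280. [folklore]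
* A. Huber, G. Wüstholz, *Transcendence and Linear Relations of 1-Periods*, Cambridge Tracts 227,
  CUP 2022, Thm. 15.3 (1). [HuberWustholz2022]
-/

noncomputable section

open Complex MvPolynomial Module
open scoped PeriodPair

namespace Literature.NumberTheory.Transcendental

namespace GaGmEFam

namespace Std

open GaGmE (Kbar)
open GaGmE.Std (iy iz is coords coords_iy coords_iz coords_is ThetaIdx rest mem_rest_iff sum_split2
  flipKappa flipMap flipMap_iz_self flipMap_iz_of_ne flipMap_iy flipMap_is flipMap_flipMap flipKappa_flipKappa
  tvKappa tvMap tvMap_iz_fst tvMap_iz_of_ne tvMap_iy tvMap_is flipRow tvRow flipRow_apply tvRow_apply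
  flipRow_ratCast tvRow_ratCast flipRow_intCast tvRow_intCast sum_flipRow_mul_flipMap sum_tvRow_mul_tvMap
  map_span_ratCast mem_span_map_of_mem flipHom tvHom tvInv tvInv_tvMap tvMap_tvInv castQ absSum
  eq_zero_of_absSum_eq_zero absSum_update exists_int_multiple flipRow_single_of_ne tvRow_single_of_ne
  castQ_flipRow castQ_tvRow coordSpan single_mem_coordSpan finrank_coordSpan)

variable {𝓙 : Type} [DecidableEq 𝓙] {β γ δ : Type} [Fintype β] [Fintype γ] [Fintype δ] [DecidableEq γ]
variable (L : 𝓙 → PeriodPair) (cls : γ → 𝓙) (κM : δ → γ → Kbar)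

/-! ### The row operations are block-diagonal inside a class -/

omit [Fintype γ] in
/-- The sign change of a coordinate commutes with the restriction to a class. [folklore] -/
theorem restr_flipRow (b₀ : γ) (i : 𝓙) (c : γ → ℚ) :
    restr cls i (flipRow ℚ b₀ c) = flipRow ℚ b₀ (restr cls i c) := by
  funext b
  rw [flipRow_apply]
  by_cases hb : b = b₀
  · subst hb
    rw [if_pos rfl]
    by_cases hc : cls b = i
    · rw [restr_apply_of_eq cls hc, restr_apply_of_eq cls hc, flipRow_apply, if_pos rfl]
    · rw [restr_apply_of_ne cls hc, restr_apply_of_ne cls hc, neg_zero]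
  · rw [if_neg hb]
    by_cases hc : cls b = i
    · rw [restr_apply_of_eq cls hc, restr_apply_of_eq cls hc, flipRow_apply, if_neg hb]
    · rw [restr_apply_of_ne cls hc, restr_apply_of_ne cls hc]

omit [Fintype γ] in
/-- A transvection between two coordinates of the same class commutes with the restriction to a
class. [folklore] -/
theorem restr_tvRow {b₁ b₂ : γ} (h12 : b₁ ≠ b₂) (hcl : cls b₂ = cls b₁) (i : 𝓙) (c : γ → ℚ) :
    restr cls i (tvRow ℚ b₁ b₂ h12 c) = tvRow ℚ b₁ b₂ h12 (restr cls i c) := by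
  funext b
  rw [tvRow_apply]
  by_cases hb : b = b₂
  · subst hb
    rw [if_pos rfl]
    by_cases hc : cls b = i
    · rw [restr_apply_of_eq cls hc, restr_apply_of_eq cls hc, restr_apply_of_eq cls (hcl ▸ hc), tvRow_apply,
        if_pos rfl]
    · rw [restr_apply_of_ne cls hc, restr_apply_of_ne cls hc, restr_apply_of_ne cls (hcl ▸ hc), sub_zero]
  · rw [if_neg hb]
    by_cases hc : cls b = i
    · rw [restr_apply_of_eq cls hc, restr_apply_of_eq cls hc, tvRow_apply, if_neg hb]
    · rw [restr_apply_of_ne cls hc, restr_apply_of_ne cls hc]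

/-! ### The transported data -/

/-- **The datum transported along the flip** of the coordinate `b₀` (for the flipped `κ`). [folklore] -/
def flipData (b₀ : γ) (K : SubgroupDataC β γ δ cls κM) : SubgroupDataC β γ δ cls (flipKappa κM b₀) where
  A := K.A
  C := K.C.map (flipRow ℚ b₀ : (γ → ℚ) →ₗ[ℚ] (γ → ℚ))
  blockDiag := by
    rintro _ hc' i
    obtain ⟨c, hc, rfl⟩ := Submodule.mem_map.mp hc'
    refine Submodule.mem_map.mpr ⟨restr cls i c, K.blockDiag c hc i, ?_⟩
    exact (restr_flipRow cls b₀ i c).symm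
  Ξ := K.Ξ
  compat ξ hξ := by
    have hv := mem_span_map_of_mem (flipRow ℚ b₀) (flipRow ℂ b₀) (flipRow_ratCast b₀) K.C (K.compat ξ hξ)
    convert hv using 1
    funext b
    change ∑ e, ξ e * ((flipKappa κM b₀ e b : Kbar) : ℂ) = flipRow ℂ b₀ (fun b => ∑ e, ξ e * (κM e b : ℂ)) b
    rw [flipRow_apply]
    by_cases hb : b = b₀
    · subst hb; simp [flipKappa, Finset.sum_neg_distrib, mul_neg]
    · simp [flipKappa, hb]

/-- **The datum transported along the transvection** `z'_{b₁} ↦ z'_{b₁} + z'_{b₂}`. [folklore] -/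
def tvData {b₁ b₂ : γ} (h12 : b₁ ≠ b₂) (hcl : cls b₂ = cls b₁) (K : SubgroupDataC β γ δ cls κM) :
    SubgroupDataC β γ δ cls (tvKappa κM b₁ b₂) where
  A := K.A
  C := K.C.map (tvRow ℚ b₁ b₂ h12 : (γ → ℚ) →ₗ[ℚ] (γ → ℚ))
  blockDiag := by
    rintro _ hc' i
    obtain ⟨c, hc, rfl⟩ := Submodule.mem_map.mp hc'
    refine Submodule.mem_map.mpr ⟨restr cls i c, K.blockDiag c hc i, ?_⟩
    exact (restr_tvRow cls h12 hcl i c).symm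
  Ξ := K.Ξ
  compat ξ hξ := by
    have hv := mem_span_map_of_mem (tvRow ℚ b₁ b₂ h12) (tvRow ℂ b₁ b₂ h12) (tvRow_ratCast h12) K.C (K.compat ξ hξ)
    convert hv using 1
    funext b
    change ∑ e, ξ e * ((tvKappa κM b₁ b₂ e b : Kbar) : ℂ) = tvRow ℂ b₁ b₂ h12 (fun b => ∑ e, ξ e * (κM e b : ℂ)) b
    rw [tvRow_apply]
    by_cases hb : b = b₂
    · subst hb; simp [tvKappa, mul_sub, Finset.sum_sub_distrib]
    · simp [tvKappa, hb]

/-! ### Transport of `Lie G'` and of `ker` -/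

/-- **`Lie` is carried to `Lie`** by the flip. [folklore] -/
theorem mem_tangent_flipData_iff (b₀ : γ) (K : SubgroupDataC β γ δ cls κM) (w : β ⊕ (γ ⊕ δ) → ℂ) :
    flipMap b₀ w ∈ (flipData cls κM b₀ K).tangent ↔ w ∈ K.tangent := by
  rw [SubgroupDataC.mem_tangent_iff, SubgroupDataC.mem_tangent_iff]
  simp only [flipMap_iy, flipMap_is]
  refine and_congr Iff.rfl (and_congr ?_ Iff.rfl)
  change (∀ c ∈ K.C.map (flipRow ℚ b₀ : (γ → ℚ) →ₗ[ℚ] (γ → ℚ)), _) ↔ _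
  constructor
  · intro h c hc
    have := h _ (Submodule.mem_map_of_mem hc)
    rwa [LinearEquiv.coe_coe, sum_flipRow_mul_flipMap] at this
  · intro h c' hc'
    obtain ⟨c, hc, rfl⟩ := Submodule.mem_map.mp hc'
    rw [LinearEquiv.coe_coe, sum_flipRow_mul_flipMap]
    exact h c hc

/-- **`Lie` is carried to `Lie`** by the transvection. [folklore] -/
theorem mem_tangent_tvData_iff {b₁ b₂ : γ} (h12 : b₁ ≠ b₂) (hcl : cls b₂ = cls b₁) (K : SubgroupDataC β γ δ cls κM) (w : β ⊕ (γ ⊕ δ) → ℂ) :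
    tvMap b₁ b₂ w ∈ (tvData cls κM h12 hcl K).tangent ↔ w ∈ K.tangent := by
  rw [SubgroupDataC.mem_tangent_iff, SubgroupDataC.mem_tangent_iff]
  simp only [tvMap_iy, tvMap_is]
  refine and_congr Iff.rfl (and_congr ?_ Iff.rfl)
  change (∀ c ∈ K.C.map (tvRow ℚ b₁ b₂ h12 : (γ → ℚ) →ₗ[ℚ] (γ → ℚ)), _) ↔ _
  constructor
  · intro h c hc
    have := h _ (Submodule.mem_map_of_mem hc)
    rwa [LinearEquiv.coe_coe, sum_tvRow_mul_tvMap h12] at this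
  · intro h c' hc'
    obtain ⟨c, hc, rfl⟩ := Submodule.mem_map.mp hc'
    rw [LinearEquiv.coe_coe, sum_tvRow_mul_tvMap h12]
    exact h c hc

omit [Fintype β] [Fintype δ] in
omit [DecidableEq 𝓙] in
/-- **`ker` is carried into `ker`** by the flip (`η` is odd on `Λ`). [folklore] -/
theorem flipMap_mem_ker (b₀ : γ) {k : β ⊕ (γ ⊕ δ) → ℂ} (hk : k ∈ ker L cls κM) :
    flipMap b₀ k ∈ ker L cls (flipKappa κM b₀) := by
  obtain ⟨hy, m, n, hz, hs⟩ := hk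
  refine ⟨fun j => by simpa using hy j, flipRow ℤ b₀ m, flipRow ℤ b₀ n, fun b => ?_, fun e => ?_⟩
  · rw [flipRow_apply, flipRow_apply]
    by_cases hb : b = b₀
    · subst hb; rw [if_pos rfl, if_pos rfl, flipMap_iz_self, hz]; push_cast; ring
    · rw [if_neg hb, if_neg hb, flipMap_iz_of_ne hb, hz]
  · rw [flipMap_is, hs e]
    refine Finset.sum_congr rfl fun b _ => ?_
    rw [flipRow_apply, flipRow_apply]
    by_cases hb : b = b₀
    · subst hb; simp [flipKappa]; ring
    · simp [flipKappa, hb]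

omit [Fintype β] [Fintype δ] in
omit [DecidableEq 𝓙] in
/-- **`ker` is carried into `ker`** by the transvection (`η` is additive on `Λ`). [folklore] -/
theorem tvMap_mem_ker {b₁ b₂ : γ} (h12 : b₁ ≠ b₂) (hcl : cls b₂ = cls b₁) {k : β ⊕ (γ ⊕ δ) → ℂ} (hk : k ∈ ker L cls κM) :
    tvMap b₁ b₂ k ∈ ker L cls (tvKappa κM b₁ b₂) := by
  obtain ⟨hy, m, n, hz, hs⟩ := hk
  refine ⟨fun j => by simpa using hy j, Function.update m b₁ (m b₁ + m b₂), Function.update n b₁ (n b₁ + n b₂),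
    fun b => ?_, fun e => ?_⟩
  · by_cases hb : b = b₁
    · subst hb; rw [tvMap_iz_fst, Function.update_self, Function.update_self, hz, hz, hcl]; push_cast; ring
    · rw [tvMap_iz_of_ne hb, Function.update_of_ne hb, Function.update_of_ne hb, hz]
  · rw [tvMap_is, hs e, sum_split2 h12, sum_split2 h12 (fun b => ((tvKappa κM b₁ b₂ e b : Kbar) : ℂ) * _)]
    have hrest : ∑ b ∈ rest b₁ b₂, ((tvKappa κM b₁ b₂ e b : Kbar) : ℂ) *
        ((Function.update m b₁ (m b₁ + m b₂) b : ℂ) * (L (cls b)).η₁ + (Function.update n b₁ (n b₁ + n b₂) b : ℂ) * (L (cls b)).η₂) =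
        ∑ b ∈ rest b₁ b₂, (κM e b : ℂ) * ((m b : ℂ) * (L (cls b)).η₁ + (n b : ℂ) * (L (cls b)).η₂) := by
      refine Finset.sum_congr rfl fun b hb => ?_
      obtain ⟨hb1, hb2⟩ := mem_rest_iff.mp hb
      rw [Function.update_of_ne hb1, Function.update_of_ne hb1]
      simp [tvKappa, hb2]
    rw [hrest, Function.update_self, Function.update_self, Function.update_of_ne h12.symm,
      Function.update_of_ne h12.symm]
    have hk1 : ((tvKappa κM b₁ b₂ e b₁ : Kbar) : ℂ) = κM e b₁ := by simp [tvKappa, h12]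
    have hk2 : ((tvKappa κM b₁ b₂ e b₂ : Kbar) : ℂ) = (κM e b₂ : ℂ) - κM e b₁ := by simp [tvKappa]
    rw [hk1, hk2, hcl]
    push_cast
    ring

/-! ### Transport of the preimage `Lie G' + ker` -/

omit [DecidableEq γ] in
/-- **Image of a preimage subgroup under an additive bijection carrying `Lie` to `Lie` and `ker`
to `ker`.** [folklore] -/
theorem image_preimageSubgroup_eq {κM' : δ → γ → Kbar} (Ψ : (β ⊕ (γ ⊕ δ) → ℂ) →+ (β ⊕ (γ ⊕ δ) → ℂ))
    (K : SubgroupDataC β γ δ cls κM) (K' : SubgroupDataC β γ δ cls κM')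
    (htan : (Ψ : (β ⊕ (γ ⊕ δ) → ℂ) → _) '' (K.tangent : Set (β ⊕ (γ ⊕ δ) → ℂ)) = K'.tangent)
    (hker : (Ψ : (β ⊕ (γ ⊕ δ) → ℂ) → _) '' ker L cls κM = ker L cls κM') :
    (Ψ : (β ⊕ (γ ⊕ δ) → ℂ) → _) '' (preimageSubgroup L cls κM K : Set (β ⊕ (γ ⊕ δ) → ℂ)) =
      preimageSubgroup L cls κM' K' := by
  have h1 : (K.tangent.toAddSubgroup).map Ψ = K'.tangent.toAddSubgroup := by
    ext v
    rw [AddSubgroup.mem_map]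
    change (∃ x ∈ (K.tangent : Set _), Ψ x = v) ↔ v ∈ (K'.tangent : Set _)
    rw [← htan, Set.mem_image]
  have h2 : (AddSubgroup.closure (ker L cls κM)).map Ψ = AddSubgroup.closure (ker L cls κM') := by
    rw [AddMonoidHom.map_closure, hker]
  rw [← AddSubgroup.coe_map, preimageSubgroup, AddSubgroup.map_sup, h1, h2]
  rfl

omit [DecidableEq γ] in
/-- **Preimage form**: for `Ψ` injective as well, `Ψ⁻¹(exp⁻¹ G'_{K'}) = exp⁻¹ G'_K`. [folklore] -/
theorem preimage_preimageSubgroup_eq {κM' : δ → γ → Kbar} (Ψ : (β ⊕ (γ ⊕ δ) → ℂ) →+ (β ⊕ (γ ⊕ δ) → ℂ))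
    (hΨ : Function.Injective Ψ) (K : SubgroupDataC β γ δ cls κM) (K' : SubgroupDataC β γ δ cls κM')
    (htan : (Ψ : (β ⊕ (γ ⊕ δ) → ℂ) → _) '' (K.tangent : Set (β ⊕ (γ ⊕ δ) → ℂ)) = K'.tangent)
    (hker : (Ψ : (β ⊕ (γ ⊕ δ) → ℂ) → _) '' ker L cls κM = ker L cls κM') :
    (Ψ : (β ⊕ (γ ⊕ δ) → ℂ) → _) ⁻¹' (preimageSubgroup L cls κM' K' : Set (β ⊕ (γ ⊕ δ) → ℂ)) =
      preimageSubgroup L cls κM K := by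
  rw [← image_preimageSubgroup_eq L cls κM Ψ K K' htan hker, Set.preimage_image_eq _ hΨ]

/-- **The flip carries `exp⁻¹(G'_K)` onto `exp⁻¹(G'_{K'})`** (preimage form). [folklore] -/
theorem preimage_flipMap_preimageSubgroup (b₀ : γ) (K : SubgroupDataC β γ δ cls κM) :
    flipMap b₀ ⁻¹' (preimageSubgroup L cls (flipKappa κM b₀) (flipData cls κM b₀ K) : Set (β ⊕ (γ ⊕ δ) → ℂ)) =
      preimageSubgroup L cls κM K := by
  have hinv : ∀ w : β ⊕ (γ ⊕ δ) → ℂ, flipMap b₀ (flipMap b₀ w) = w := flipMap_flipMap b₀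
  refine preimage_preimageSubgroup_eq L cls κM (flipHom b₀) (fun v w h => by
    have := congrArg (flipMap b₀) h; simpa [flipHom, hinv] using this) K _ ?_ ?_
  · ext v
    simp only [Set.mem_image, SetLike.mem_coe]
    constructor
    · rintro ⟨w, hw, rfl⟩; exact (mem_tangent_flipData_iff cls κM b₀ K w).mpr hw
    · intro hv
      refine ⟨flipMap b₀ v, ?_, hinv v⟩
      have := (mem_tangent_flipData_iff cls κM b₀ K (flipMap b₀ v)).mp
      rw [hinv] at this
      exact this hv
  · ext v
    simp only [Set.mem_image]
    constructor
    · rintro ⟨w, hw, rfl⟩; exact flipMap_mem_ker L cls κM b₀ hw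
    · intro hv
      refine ⟨flipMap b₀ v, ?_, hinv v⟩
      have := flipMap_mem_ker L cls (flipKappa κM b₀) b₀ hv
      rwa [flipKappa_flipKappa] at this

/-- **The transvection carries `exp⁻¹(G'_K)` onto `exp⁻¹(G'_{K'})`** (preimage form). [folklore] -/
theorem preimage_tvMap_preimageSubgroup {b₁ b₂ : γ} (h12 : b₁ ≠ b₂) (hcl : cls b₂ = cls b₁) (K : SubgroupDataC β γ δ cls κM) :
    tvMap b₁ b₂ ⁻¹' (preimageSubgroup L cls (tvKappa κM b₁ b₂) (tvData cls κM h12 hcl K) : Set (β ⊕ (γ ⊕ δ) → ℂ)) =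
      preimageSubgroup L cls κM K := by
  refine preimage_preimageSubgroup_eq L cls κM (tvHom b₁ b₂) (fun v w h => by
    have := congrArg (tvInv b₁ b₂) h; simpa [tvHom, tvInv_tvMap h12] using this) K _ ?_ ?_
  · ext v
    simp only [Set.mem_image, SetLike.mem_coe]
    constructor
    · rintro ⟨w, hw, rfl⟩; exact (mem_tangent_tvData_iff cls κM h12 hcl K w).mpr hw
    · intro hv
      refine ⟨tvInv b₁ b₂ v, ?_, tvMap_tvInv h12 v⟩
      have := (mem_tangent_tvData_iff cls κM h12 hcl K (tvInv b₁ b₂ v)).mp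
      rw [tvMap_tvInv h12] at this
      exact this hv
  · ext v
    simp only [Set.mem_image]
    constructor
    · rintro ⟨w, hw, rfl⟩; exact tvMap_mem_ker L cls κM h12 hcl hw
    · intro hv
      refine ⟨tvInv b₁ b₂ v, ?_, tvMap_tvInv h12 v⟩
      -- the inverse transvection carries `ker'` back into `ker`
      obtain ⟨hy, m, n, hz, hs⟩ := hv
      refine ⟨fun j => by simpa [tvInv] using hy j, Function.update m b₁ (m b₁ - m b₂),
        Function.update n b₁ (n b₁ - n b₂), fun b => ?_, fun e => ?_⟩
      · by_cases hb : b = b₁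
        · subst hb
          simp only [tvInv, coords_iz, Function.update_self, hz, if_true, hcl]
          push_cast; ring
        · simp only [tvInv, coords_iz, if_neg hb, Function.update_of_ne hb, hz]
      · simp only [tvInv, coords_is, hs e]
        rw [sum_split2 h12, sum_split2 h12 (fun b => (κM e b : ℂ) * _)]
        have hrest : ∑ b ∈ rest b₁ b₂, ((tvKappa κM b₁ b₂ e b : Kbar) : ℂ) * ((m b : ℂ) * (L (cls b)).η₁ + (n b : ℂ) * (L (cls b)).η₂) =
            ∑ b ∈ rest b₁ b₂, (κM e b : ℂ) *
              ((Function.update m b₁ (m b₁ - m b₂) b : ℂ) * (L (cls b)).η₁ + (Function.update n b₁ (n b₁ - n b₂) b : ℂ) * (L (cls b)).η₂) := by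
          refine Finset.sum_congr rfl fun b hb => ?_
          obtain ⟨hb1, hb2⟩ := mem_rest_iff.mp hb
          rw [Function.update_of_ne hb1, Function.update_of_ne hb1]
          simp [tvKappa, hb2]
        rw [hrest, Function.update_self, Function.update_self, Function.update_of_ne h12.symm,
          Function.update_of_ne h12.symm]
        have hk1 : ((tvKappa κM b₁ b₂ e b₁ : Kbar) : ℂ) = κM e b₁ := by simp [tvKappa, h12]
        have hk2 : ((tvKappa κM b₁ b₂ e b₂ : Kbar) : ℂ) = (κM e b₂ : ℂ) - κM e b₁ := by simp [tvKappa]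
        rw [hk1, hk2, hcl]
        push_cast
        ring

/-! ### Definability is carried back along the operations -/

/-- **Flip step**: definability of `exp⁻¹(G'_{K'})` in `M_{κ'}` gives that of `exp⁻¹(G'_K)` in `M_κ`. [folklore] -/
theorem thetaDefinable_of_flip (b₀ : γ) (K : SubgroupDataC β γ δ cls κM)
    (h : ThetaDefinable L cls (flipKappa κM b₀) (preimageSubgroup L cls (flipKappa κM b₀) (flipData cls κM b₀ K) : Set (β ⊕ (γ ⊕ δ) → ℂ))) :
    ThetaDefinable L cls κM (preimageSubgroup L cls κM K : Set (β ⊕ (γ ⊕ δ) → ℂ)) := by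
  have := h.preimage L cls κM (flipKappa κM b₀) (isThetaMorphic_flip L cls κM b₀)
  rwa [preimage_flipMap_preimageSubgroup] at this

/-- **Transvection step.** [folklore] -/
theorem thetaDefinable_of_tv {b₁ b₂ : γ} (h12 : b₁ ≠ b₂) (hcl : cls b₂ = cls b₁) (K : SubgroupDataC β γ δ cls κM)
    (h : ThetaDefinable L cls (tvKappa κM b₁ b₂) (preimageSubgroup L cls (tvKappa κM b₁ b₂) (tvData cls κM h12 hcl K) : Set (β ⊕ (γ ⊕ δ) → ℂ))) :
    ThetaDefinable L cls κM (preimageSubgroup L cls κM K : Set (β ⊕ (γ ⊕ δ) → ℂ)) := by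
  have := h.preimage L cls κM (tvKappa κM b₁ b₂) (isThetaMorphic_transvection L cls κM h12 hcl)
  rwa [preimage_tvMap_preimageSubgroup L cls κM h12 hcl] at this


/-! ### One flip, one transvection -/

section Steps

variable (K : SubgroupDataC β γ δ cls κM) (S : Finset γ) (c : γ → ℤ)

/-- **The flip step** with its invariants. [folklore] -/
theorem flip_step (b₂ : γ) (hb₂ : b₂ ∉ S) (hS : ∀ b ∈ S, Pi.single b (1 : ℚ) ∈ K.C) (hc : castQ c ∈ K.C) :
    (∀ b ∈ S, Pi.single b (1 : ℚ) ∈ (flipData cls κM b₂ K).C) ∧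
      castQ (flipRow ℤ b₂ c) ∈ (flipData cls κM b₂ K).C ∧
      finrank ℚ (flipData cls κM b₂ K).C = finrank ℚ K.C ∧
      (ThetaDefinable L cls (flipKappa κM b₂) (preimageSubgroup L cls (flipKappa κM b₂) (flipData cls κM b₂ K) : Set (β ⊕ (γ ⊕ δ) → ℂ)) →
        ThetaDefinable L cls κM (preimageSubgroup L cls κM K : Set (β ⊕ (γ ⊕ δ) → ℂ))) := by
  refine ⟨fun b hb => ?_, ?_, LinearEquiv.finrank_map_eq _ _, thetaDefinable_of_flip L cls κM b₂ K⟩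
  · have : Pi.single b (1 : ℚ) = flipRow ℚ b₂ (Pi.single b 1) :=
      (flipRow_single_of_ne ℚ (ne_of_mem_of_not_mem hb hb₂)).symm
    rw [this]
    exact Submodule.mem_map_of_mem (hS b hb)
  · rw [castQ_flipRow]
    exact Submodule.mem_map_of_mem hc

/-- **The transvection step** with its invariants. [folklore] -/
theorem tv_step {b₁ b₂ : γ} (h12 : b₁ ≠ b₂) (hcl : cls b₂ = cls b₁) (hb₁ : b₁ ∉ S) (hb₂ : b₂ ∉ S)
    (hS : ∀ b ∈ S, Pi.single b (1 : ℚ) ∈ K.C) (hc : castQ c ∈ K.C) :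
    (∀ b ∈ S, Pi.single b (1 : ℚ) ∈ (tvData cls κM h12 hcl K).C) ∧
      castQ (tvRow ℤ b₁ b₂ h12 c) ∈ (tvData cls κM h12 hcl K).C ∧
      finrank ℚ (tvData cls κM h12 hcl K).C = finrank ℚ K.C ∧
      (ThetaDefinable L cls (tvKappa κM b₁ b₂) (preimageSubgroup L cls (tvKappa κM b₁ b₂) (tvData cls κM h12 hcl K) : Set (β ⊕ (γ ⊕ δ) → ℂ)) →
        ThetaDefinable L cls κM (preimageSubgroup L cls κM K : Set (β ⊕ (γ ⊕ δ) → ℂ))) := by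
  refine ⟨fun b hb => ?_, ?_, LinearEquiv.finrank_map_eq _ _, thetaDefinable_of_tv L cls κM h12 hcl K⟩
  · have : Pi.single b (1 : ℚ) = tvRow ℚ b₁ b₂ h12 (Pi.single b 1) :=
      (tvRow_single_of_ne ℚ h12 (ne_of_mem_of_not_mem hb hb₁) (ne_of_mem_of_not_mem hb hb₂)).symm
    rw [this]
    exact Submodule.mem_map_of_mem (hS b hb)
  · rw [castQ_tvRow]
    exact Submodule.mem_map_of_mem hc

end Steps

/-! ### Euclid -/

/-- **Euclidean reduction.** Given `e_b ∈ C` for `b ∈ S` and a non-zero integer vector `c ∈ C`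
vanishing on `S`, a chain of flips and transvections among the support of `c` leads to a datum
`K'` over some `κ'` with `e_b ∈ C'` for `b ∈ S ∪ {b₀}`, `b₀ ∉ S`, `dim C' = dim C`, and such that
the definability of `exp⁻¹(G'_{K'})` implies that of `exp⁻¹(G'_K)`. [folklore] -/
theorem exists_split_step (m : ℕ) :
    ∀ (κM : δ → γ → Kbar) (K : SubgroupDataC β γ δ cls κM) (S : Finset γ) (c : γ → ℤ),
      (∀ b ∈ S, Pi.single b (1 : ℚ) ∈ K.C) → castQ c ∈ K.C → (∀ b ∈ S, c b = 0) → c ≠ 0 → absSum c ≤ m →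
      (∀ b b', c b ≠ 0 → c b' ≠ 0 → cls b = cls b') →
      ∃ (κM' : δ → γ → Kbar) (K' : SubgroupDataC β γ δ cls κM') (b₀ : γ), b₀ ∉ S ∧
        (∀ b ∈ insert b₀ S, Pi.single b (1 : ℚ) ∈ K'.C) ∧ finrank ℚ K'.C = finrank ℚ K.C ∧
        (ThetaDefinable L cls κM' (preimageSubgroup L cls κM' K' : Set (β ⊕ (γ ⊕ δ) → ℂ)) →
          ThetaDefinable L cls κM (preimageSubgroup L cls κM K : Set (β ⊕ (γ ⊕ δ) → ℂ))) := by
  induction m with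
  | zero =>
    intro κM K S c _ _ _ hc0 hm _
    exact absurd (eq_zero_of_absSum_eq_zero (Nat.le_zero.mp hm)) hc0
  | succ m ih =>
    intro κM K S c hS hc hcS hc0 hm hcls
    classical
    -- a coordinate of maximal size
    set supp : Finset γ := Finset.univ.filter fun b => c b ≠ 0 with hsupp
    have hsupp_ne : supp.Nonempty := by
      by_contra h
      rw [Finset.not_nonempty_iff_eq_empty] at h
      apply hc0
      funext b
      by_contra hb
      have : b ∈ supp := Finset.mem_filter.mpr ⟨Finset.mem_univ b, hb⟩
      rw [h] at this
      exact absurd this (Finset.notMem_empty b)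
    obtain ⟨b₂, hb₂supp, hmax⟩ := Finset.exists_max_image supp (fun b => (c b).natAbs) hsupp_ne
    have hcb₂ : c b₂ ≠ 0 := (Finset.mem_filter.mp hb₂supp).2
    have hb₂S : b₂ ∉ S := fun h => hcb₂ (hcS b₂ h)
    by_cases hA : ∀ b, b ≠ b₂ → c b = 0
    · -- the support is `{b₂}`: `e_{b₂} ∈ C` already
      refine ⟨κM, K, b₂, hb₂S, fun b hb => ?_, rfl, id⟩
      rcases Finset.mem_insert.mp hb with rfl | hb
      · have hce : castQ c = (c b : ℚ) • Pi.single b (1 : ℚ) := by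
          funext b'
          by_cases hb' : b' = b
          · subst hb'; simp [castQ]
          · simp [castQ, Pi.single_eq_of_ne hb', hA b' hb']
        have hcb : (c b : ℚ) ≠ 0 := by exact_mod_cast hcb₂
        have := K.C.smul_mem (c b : ℚ)⁻¹ hc
        rwa [hce, smul_smul, inv_mul_cancel₀ hcb, one_smul] at this
      · exact hS b hb
    · -- a second coordinate `b₁` in the support, `|c b₁| ≤ |c b₂|`
      simp only [not_forall] at hA
      obtain ⟨b₁, h12, hcb₁⟩ := hA
      have hb₁S : b₁ ∉ S := fun h => hcb₁ (hcS b₁ h)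
      have hb₁supp : b₁ ∈ supp := Finset.mem_filter.mpr ⟨Finset.mem_univ _, hcb₁⟩
      have hle : (c b₁).natAbs ≤ (c b₂).natAbs := hmax b₁ hb₁supp
      -- after an optional flip at `b₂`, the two entries have the same sign; then transvect
      -- generic conclusion from a datum with the same-sign property
      have hcl : cls b₂ = cls b₁ := hcls b₂ b₁ hcb₂ hcb₁
      have key : ∀ (κ₂ : δ → γ → Kbar) (K₂ : SubgroupDataC β γ δ cls κ₂) (c₂ : γ → ℤ),
          (∀ b ∈ S, Pi.single b (1 : ℚ) ∈ K₂.C) → castQ c₂ ∈ K₂.C → (∀ b ∈ S, c₂ b = 0) →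
          (∀ b, b ≠ b₂ → c₂ b = c b) → c₂ b₁ = c b₁ → (0 < c b₁ ∧ 0 < c₂ b₂ ∨ c b₁ < 0 ∧ c₂ b₂ < 0) → (c₂ b₂).natAbs = (c b₂).natAbs →
          absSum c₂ = absSum c →
          ∃ (κM' : δ → γ → Kbar) (K' : SubgroupDataC β γ δ cls κM') (b₀ : γ), b₀ ∉ S ∧
            (∀ b ∈ insert b₀ S, Pi.single b (1 : ℚ) ∈ K'.C) ∧ finrank ℚ K'.C = finrank ℚ K₂.C ∧
            (ThetaDefinable L cls κM' (preimageSubgroup L cls κM' K' : Set (β ⊕ (γ ⊕ δ) → ℂ)) →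
              ThetaDefinable L cls κ₂ (preimageSubgroup L cls κ₂ K₂ : Set (β ⊕ (γ ⊕ δ) → ℂ))) := by
        intro κ₂ K₂ c₂ hS₂ hc₂ hcS₂ hoff h1 hsign h2abs hsum
        obtain ⟨hS₃, hc₃, hrk₃, htr₃⟩ := tv_step L cls κ₂ K₂ S c₂ h12 hcl hb₁S hb₂S hS₂ hc₂
        set c₃ := tvRow ℤ b₁ b₂ h12 c₂ with hc₃def
        have hc₃b : ∀ b, c₃ b = if b = b₂ then c₂ b₂ - c₂ b₁ else c₂ b := fun b => tvRow_apply ℤ h12 c₂ b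
        have hcS₃ : ∀ b ∈ S, c₃ b = 0 := by
          intro b hb
          rw [hc₃b, if_neg (ne_of_mem_of_not_mem hb hb₂S)]
          exact hcS₂ b hb
        have hc₃0 : c₃ ≠ 0 := by
          intro h
          have := congrFun h b₁
          rw [hc₃b, if_neg h12, h1] at this
          exact hcb₁ this
        have hsize : absSum c₃ + (c b₁).natAbs = absSum c₂ := by
          have hupd : c₃ = Function.update c₂ b₂ (c₂ b₂ - c₂ b₁) := by
            funext b; rw [hc₃b]; by_cases hb : b = b₂
            · subst hb; simp
            · simp [hb]
          have h := absSum_update c₂ b₂ (c₂ b₂ - c₂ b₁)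
          rw [← hupd] at h
          have habs : (c₂ b₂ - c₂ b₁).natAbs + (c b₁).natAbs = (c₂ b₂).natAbs := by
            rw [h1]; rcases hsign with ⟨ha, hb⟩ | ⟨ha, hb⟩ <;> omega
          omega
        have hm₃ : absSum c₃ ≤ m := by
          have : 0 < (c b₁).natAbs := Int.natAbs_pos.mpr hcb₁
          omega
        have hcls₃ : ∀ b b', c₃ b ≠ 0 → c₃ b' ≠ 0 → cls b = cls b' := by
          have hsub : ∀ b, c₃ b ≠ 0 → c b ≠ 0 := by
            intro b hb
            rw [hc₃b] at hb
            by_cases hb2 : b = b₂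
            · subst hb2; exact hcb₂
            · rw [if_neg hb2, hoff b hb2] at hb; exact hb
          exact fun b b' hb hb' => hcls b b' (hsub b hb) (hsub b' hb')
        obtain ⟨κ', K', b₀, hb₀, hS', hrk', htr'⟩ := ih _ _ S c₃ hS₃ hc₃ hcS₃ hc₃0 hm₃ hcls₃
        exact ⟨κ', K', b₀, hb₀, hS', hrk'.trans hrk₃, fun h => htr₃ (htr' h)⟩
      by_cases hsign : 0 < c b₁ * c b₂
      · -- same sign: transvect directly
        have hs : 0 < c b₁ ∧ 0 < c b₂ ∨ c b₁ < 0 ∧ c b₂ < 0 := by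
          rcases lt_trichotomy 0 (c b₁) with h | h | h
          · exact Or.inl ⟨h, pos_of_mul_pos_right hsign h.le⟩
          · exact absurd h.symm hcb₁
          · exact Or.inr ⟨h, neg_of_mul_pos_right hsign h.le⟩
        exact key κM K c hS hc hcS (fun _ _ => rfl) rfl hs rfl rfl
      · -- opposite signs: flip `b₂` first
        have hneg : c b₁ * c b₂ < 0 := lt_of_le_of_ne (not_lt.mp hsign) (mul_ne_zero hcb₁ hcb₂)
        obtain ⟨hS₂, hc₂, hrk₂, htr₂⟩ := flip_step L cls κM K S c b₂ hb₂S hS hc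
        set c₂ := flipRow ℤ b₂ c with hc₂def
        have hc₂b : ∀ b, c₂ b = if b = b₂ then -c b₂ else c b := fun b => flipRow_apply ℤ b₂ c b
        have hcS₂ : ∀ b ∈ S, c₂ b = 0 := by
          intro b hb
          rw [hc₂b, if_neg (ne_of_mem_of_not_mem hb hb₂S)]
          exact hcS b hb
        have h1 : c₂ b₁ = c b₁ := by rw [hc₂b, if_neg h12]
        have h2 : c₂ b₂ = -c b₂ := by rw [hc₂b, if_pos rfl]
        have hs : 0 < c b₁ ∧ 0 < c₂ b₂ ∨ c b₁ < 0 ∧ c₂ b₂ < 0 := by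
          rw [h2]
          rcases lt_trichotomy 0 (c b₁) with h | h | h
          · exact Or.inl ⟨h, by nlinarith [neg_of_mul_neg_right hneg h.le]⟩
          · exact absurd h.symm hcb₁
          · refine Or.inr ⟨h, ?_⟩
            have := pos_of_mul_neg_right hneg h.le
            linarith
        have h2abs : (c₂ b₂).natAbs = (c b₂).natAbs := by rw [h2, Int.natAbs_neg]
        have hsum : absSum c₂ = absSum c := by
          have hupd : c₂ = Function.update c b₂ (-c b₂) := by
            funext b; rw [hc₂b]; by_cases hb : b = b₂
            · subst hb; simp
            · simp [hb]
          have h := absSum_update c b₂ (-c b₂)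
          rw [← hupd, Int.natAbs_neg] at h
          omega
        obtain ⟨κ', K', b₀, hb₀, hS', hrk', htr'⟩ := key _ _ c₂ hS₂ hc₂ hcS₂ (fun b hb => by rw [hc₂b, if_neg hb]) h1 hs h2abs hsum
        exact ⟨κ', K', b₀, hb₀, hS', hrk'.trans hrk₂, fun h => htr₂ (htr' h)⟩

/-! ### Definability for every datum -/

/-- Induction on `dim C - |S|`. [folklore] -/
theorem thetaDefinable_preimageSubgroup_aux (n : ℕ) :
    ∀ (κM : δ → γ → Kbar) (K : SubgroupDataC β γ δ cls κM) (S : Finset γ),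
      (∀ b ∈ S, Pi.single b (1 : ℚ) ∈ K.C) → finrank ℚ K.C = S.card + n →
      ThetaDefinable L cls κM (preimageSubgroup L cls κM K : Set (β ⊕ (γ ⊕ δ) → ℂ)) := by
  induction n with
  | zero =>
    intro κM K S hS hrk
    have hle : coordSpan S ≤ K.C := Submodule.span_le.mpr (by rintro _ ⟨b, hb, rfl⟩; exact hS b hb)
    have heq : coordSpan S = K.C :=
      Submodule.eq_of_le_of_finrank_eq hle (by rw [finrank_coordSpan, hrk, add_zero])
    exact thetaDefinable_preimageSubgroup_of_split L cls κM K S heq.symm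
  | succ n ih =>
    intro κM K S hS hrk
    classical
    -- a vector of `C` outside the coordinate span, made to vanish on `S`, made integral
    have hnot : ¬ K.C ≤ coordSpan S := by
      intro hle
      have := Submodule.finrank_mono hle
      rw [finrank_coordSpan, hrk] at this
      omega
    obtain ⟨v, hvC, hvS⟩ := SetLike.not_le_iff_exists.mp hnot
    set v' : γ → ℚ := v - ∑ b ∈ S, v b • (Pi.single b (1 : ℚ) : γ → ℚ) with hv'
    have hv'C : v' ∈ K.C := K.C.sub_mem hvC (Submodule.sum_mem _ fun b hb => Submodule.smul_mem _ _ (hS b hb))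
    have hv'S : ∀ b ∈ S, v' b = 0 := by
      intro b hb
      simp only [hv', Pi.sub_apply, Finset.sum_apply, Pi.smul_apply, smul_eq_mul]
      rw [Finset.sum_eq_single b (fun b' _ hb' => by rw [Pi.single_eq_of_ne (Ne.symm hb'), mul_zero])
        (fun h => absurd hb h)]
      simp
    have hv'0 : v' ≠ 0 := by
      intro h
      apply hvS
      have : v = ∑ b ∈ S, v b • (Pi.single b (1 : ℚ) : γ → ℚ) := by
        rw [← sub_eq_zero]; exact h
      rw [this]
      exact Submodule.sum_mem _ fun b hb => Submodule.smul_mem _ _ (single_mem_coordSpan hb)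
    -- restrict to one class (block-diagonality)
    obtain ⟨b₃, hb₃⟩ : ∃ b, v' b ≠ 0 := by
      by_contra h
      push Not at h
      exact hv'0 (funext h)
    set v'' : γ → ℚ := restr cls (cls b₃) v' with hv''
    have hv''C : v'' ∈ K.C := K.blockDiag v' hv'C (cls b₃)
    have hv''S : ∀ b ∈ S, v'' b = 0 := by
      intro b hb
      by_cases hcb : cls b = cls b₃
      · rw [hv'', restr_apply_of_eq cls hcb]; exact hv'S b hb
      · rw [hv'', restr_apply_of_ne cls hcb]
    have hv''0 : v'' ≠ 0 := by
      intro h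
      have := congrFun h b₃
      rw [hv'', restr_apply_of_eq cls rfl] at this
      exact hb₃ this
    have hv''cls : ∀ b, v'' b ≠ 0 → cls b = cls b₃ := by
      intro b hb
      by_contra hcb
      exact hb (by rw [hv'', restr_apply_of_ne cls hcb])
    obtain ⟨d, c, hd, hdc⟩ := exists_int_multiple v''
    have hcQ : castQ c = (d : ℚ) • v'' := by funext b; simp [castQ, hdc b]
    have hcC : castQ c ∈ K.C := by rw [hcQ]; exact K.C.smul_mem _ hv''C
    have hcS : ∀ b ∈ S, c b = 0 := by
      intro b hb
      have := hdc b
      rw [hv''S b hb, mul_zero] at this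
      exact_mod_cast this
    have hd' : (d : ℚ) ≠ 0 := by exact_mod_cast hd
    have hc0 : c ≠ 0 := by
      intro h
      apply hv''0
      funext b
      have := hdc b
      rw [h] at this
      simp only [Pi.zero_apply, Int.cast_zero] at this
      exact (mul_eq_zero.mp this.symm).resolve_left hd'
    have hcls : ∀ b b', c b ≠ 0 → c b' ≠ 0 → cls b = cls b' := by
      have hsub : ∀ b, c b ≠ 0 → v'' b ≠ 0 := by
        intro b hb hv
        have := hdc b
        rw [hv, mul_zero] at this
        exact hb (by exact_mod_cast this)
      intro b b' hb hb'
      rw [hv''cls b (hsub b hb), hv''cls b' (hsub b' hb')]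
    obtain ⟨κ', K', b₀, hb₀, hS', hrk', htr⟩ :=
      exists_split_step L cls (absSum c) κM K S c hS hcC hcS hc0 le_rfl hcls
    refine htr (ih κ' K' (insert b₀ S) hS' ?_)
    rw [hrk', hrk, Finset.card_insert_of_notMem hb₀]
    ring

/-- **`exp⁻¹(G') = Lie G' + ker(exp)` is `Θ`-definable for EVERY connected algebraic subgroup
datum of `M_κ`.** [cite: NesterenkoPhilippon2001, Ch. 11 Thm. 4.1 (the algebraic subgroups are cut out by forms)] -/
theorem thetaDefinable_preimageSubgroup (K : SubgroupDataC β γ δ cls κM) :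
    ThetaDefinable L cls κM (preimageSubgroup L cls κM K : Set (β ⊕ (γ ⊕ δ) → ℂ)) :=
  thetaDefinable_preimageSubgroup_aux L cls (finrank ℚ K.C) κM K ∅ (fun _ h => absurd h (Finset.notMem_empty _))
    (by simp)

/-! ### In a theta model: `Z(𝔍(Lie G')) ⊆ exp⁻¹(G')` -/

section Model

variable {N : ℕ} (M : AnalyticGroupModel (β ⊕ (γ ⊕ δ) → ℂ) N) (e : Option β × ThetaIdx γ δ ≃ Fin (N + 1))
variable (hΘ : ∀ J w, M.Θ (e J) w = theta L cls κM J w)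
include hΘ

/-- **The closure of the Lie algebra of a connected algebraic subgroup lies in its preimage**:
`Z(𝔍(Lie G')) ⊆ Lie G' + ker(exp)`, for every datum `K` (any number of elliptic factors; this
uses no hypothesis on complex multiplication). [cite: NesterenkoPhilippon2001, Ch. 11 Thm. 4.1] -/
theorem zeroSet_vanishing_tangent_subset_preimageSubgroup (K : SubgroupDataC β γ δ cls κM) :
    M.zeroSet ((M.vanishing (K.tangent : Set (β ⊕ (γ ⊕ δ) → ℂ)) : Ideal _) :
        Set (MvPolynomial (Fin (N + 1)) ℂ)) ⊆ preimageSubgroup L cls κM K :=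
  zeroSet_vanishing_subset_of_thetaDefinable L cls κM M e hΘ (thetaDefinable_preimageSubgroup L cls κM K)
    fun _ hw => AddSubgroup.mem_sup_left hw

end Model

end Std

end GaGmEFam

end Literature.NumberTheory.Transcendental

end
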